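import Summits.QuantumFields.YangMills.Theorems.BalabanUVNodesN21AtRRec12Mixture

/-!
# YM-DAG node N21 (= NE7c) — THE N21 SLOT OF K3′'s COMPOSITE AT THE STAGE-12 HOMES, ROAD I BY NAME WITH (M1)-BY-LEVEL CROSSED OUT: in-edge N16 as the composite's
# own K4 stub `S_N16 (RRec₁₂ 𝔯)` at a CONSTANT NE3 layer (modules 10 ∕ 12b), both level ledgers from SHARP PUSHES uniform in the threshold (module 12a, ROW A′), the
# two-run width read through the [dict] clauses — conclusion `Spine ₁₂C` via module 9's ∃-weight currency

Track A of `YM-PLAN.md` (cell `pub-ymgap`, HUMAN RULING D-0062), node **N21**; R134 fan-out seat `pub-ymgap-dag-n21-d` (s2 = BY-NAME KNIT at the record), generation 3,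
module 14 (the composite form of module 12b §3).  THEOREMS ONLY: 0 `def`, 0 `sorry`, standard axioms; COUNT-NEUTRAL; `--supports` the K3′ item `SpineGivenEndpointR12` (rev 15,
stmt-QuantumFields-19908) as a helper.  `N`-generic, NO Theses import (restate-immune).  Imports module 12b `BalabanUVNodesN21AtRRec12Mixture` (p472546:
`shellWeightBound_geometric_of_rRec₁₂_constLayer_thresholdMixture`; through it modules 9 ∕ 10 ∕ 12a and dag-n27-c XXVII).  Restates nothing; cites by name.

WHAT IS PROVED ([bookkeeping]; ONE theorem, each step ONE application BY NAME).
* `spine_rec12C_of_homes₁₂_constLayer_thresholdMixture` — dag-n27-c XXVII's composite at the homes (six K4 stubs at `RRec₁₂ 𝔯`, `S_N27x ₁₂C (SRec₁₂ cr)`, `S_N20 (SRec₁₂ cr)`, the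
  home-keyed N19′ edge) with THE N21 SLOT SUPPLIED ON ROAD I BY NAME, (M1) CROSSED OUT: a rate reading with constant NE3 component `o F` (`hconst`), THE END's proviso and
  the two numerals at the layer, and — at every admissible Stage-12 tuple with provisos — the SHARP-PUSH MIXTURE DATA of the carriers `cr F θ hP g₀ os` for both runs
  (module 12a §2's binders), live windows, admissible widths bounded below, a threshold unit `ε′`, a flux letter `cg`, threshold widths `τ ≤ c₂ϑ₂^j` and the two [dict]
  clauses at `o F` (`hmixdict`); the in-edge N16 is the composite's own `h16 : S_N16 (RRec₁₂ 𝔯)` (serving twice; datum key `Node00.isDatumOfRecord₁₂C_datumOfRecord₁₂`).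
  Per tuple module 12b §3 gives `∃ ϑ C, … ShellWeightBound (cr …) … (K ↦ C·ϑ^K)`, hence module 9's ∃-weight certificate; conclusion `Spine ₁₂C`.

HONEST FRAMING (binding).  Compared with module 10's `spine_rec12C_of_homes₁₂_constLayer`, the two `LevelLedger` binders ((M1)-by-level + (R) + [dict]-widths) inside `hread`
are REPLACED by sharp pushes + (R) + carriers pinned as window averages — the mixture road, a convex combination of print's sharp procedure over admissible thresholds, NOT
print's construction verbatim; (M1) for the deterministic sharp procedure UNTOUCHED.  Every K4 ∕ K5 stub, the edge, `InEndRegime`, the sharp pushes (NODE O at ₁₂,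
(O-mix-1′∕2∕3′)), windows (N20), threshold widths (U2's rate as a displayed letter), the [dict] clauses (incl. the (0.4)∕(42) averaging transfer — GAP-STATED of record) are
HYPOTHESES; `cr`, `𝔯` PARAMETERS; no inhabitant of `IsDatumOfRecord₁₂C` claimed (K0′ open); nothing of Bałaban's asserted; NE3 ∕ NE7 ∕ NE7b ∕ NE7c NOT PRINTED for d = 4 and NOT
PROVED; **N21 NOT discharged**, N27 NOT discharged, K3′ NOT claimed; typed 28∕28, discharged count untouched; one finite four-torus programme at fixed `ε` — NOT ℝ⁴, NOT infinite
volume, NOT OS, NOT a mass gap, NOT Clay.  No decl below carries a cite tag.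
-/

set_option autoImplicit false

noncomputable section

open scoped BigOperators Matrix Matrix.Norms.L2Operator ENNReal
open MeasureTheory Set

namespace Summit.QuantumFields.YangMills.Theorems.N21AtRRec12ConstLayerMixture

open Literature.MathematicalPhysics.QuantumFieldTheory.Balaban1983to89
open Literature.MathematicalPhysics.QuantumFieldTheory.Balaban1983to89.T4Continuum (T4Family ULoop)
open B7Prop1Explicit B7Prop2Explicit
open T4AveragingDeficitWall (Plane)
open T4IndicatorShell (ShellWeightBound)
open T4ShellMeasureLevels (LevelLedger LiveWindow)
open Summit.QuantumFields.BalabanUV.T4Continuum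
open Summit.QuantumFields.BalabanUV.T4Continuum.Spine
open MinimalActionSandwich (IsMinimiser)
open MinimalActionRate (Regular sfClass)
open MinimalActionRefine (RegularSup)
open YMDAG.UVSplit
open Summit.QuantumFields.YangMills.BalabanUVNodes.N16Regime (InEndRegime)
open N21AtSRec12Weight (spine_rec12C_of_homes₁₂_existsShellWeight)
open N21AtRRec12Mixture (shellWeightBound_geometric_of_rRec₁₂_constLayer_thresholdMixture)
open Node00 (NE3Objects₁₁ Stage12Params IsDatumOfRecord₁₂C IsRecordOfRecord₁₂C datumOfRecord₁₂ isDatumOfRecord₁₂C_datumOfRecord₁₂)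

variable {N : ℕ} [NeZero N]

/-- **N27 = B5 AT THE STAGE-12 RECORD FROM THE HOMES — THE N21 SLOT ON ROAD I BY NAME WITH (M1) CROSSED OUT.**  HYPOTHESES: a spine reading `cr`; a rate reading `𝔯` with
constant NE3 component `o F` (`hconst`); THE END's proviso `InEndRegime` and the two numerals at the layer of every family; `hmixdict` — at every admissible Stage-12 tuple with
provisos and every `(g₀, os)`: module 12a's sharp-push mixture data of the carriers `cr F θ hP g₀ os` for BOTH runs ((R), per-slot finite field laws with measurable tested
variables, `θ_j > 0`, `0 < κ_j < 1`, `ρ_j ≥ 0`, `M ≥ 0`, integrable sharp piece ∕ weight families with the two pushes at EVERY threshold of each slot's window, pieces AND weights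
pinned as normalised window averages), the live windows `(N₁, ν̄)`, `κ_min ≤ κ_j`, a threshold unit `ε′ > 0`, a flux letter `cg ≥ 0`, threshold widths `τ ≤ c₂ϑ₂^j`
(`0 ≤ c₂`, `0 ≤ ϑ₂ < 1`) and the two [dict] clauses at `o F`; the composite's own stubs `h14 … h22` at `RRec₁₂ 𝔯` (N16's `h16` ALSO being N21's in-edge), `S_N27x`, `S_N20`
at `SRec₁₂ cr`, and the home-keyed N19′ edge `h19`.  CONCLUSION: `Spine ₁₂C` — module 12b §3 per tuple (datum key `isDatumOfRecord₁₂C_datumOfRecord₁₂`), then module 9's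
`spine_rec12C_of_homes₁₂_existsShellWeight`.  Every binder a HYPOTHESIS (0∕1 today); N21 ∕ N27 NOT discharged; K3′ NOT claimed. [bookkeeping] -/
theorem spine_rec12C_of_homes₁₂_constLayer_thresholdMixture (cr : SpineReading₁₂ N) (𝔯 : RateReading₁₂ N) (o : T4Family → NE3Objects₁₁ N)
    (hconst : ∀ (F : T4Family) (θ : Stage12Params F N) (hP : θ.Provisos₁₂ F N) (g₀ : ℕ → ℝ) (os : List (ULoop F)) (k : ℕ), (𝔯.lit F θ hP g₀ os).ne3 k = o F)
    (hreg : ∀ F : T4Family, InEndRegime (ne3OfRecord₁₁ F (o F)))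
    (hnum : ∀ F : T4Family, 512 * (4 + 1) * (4 + 4) * (F.L : ℝ) ^ 2 * (o F).b ≤ 1 ∧ 0 < (o F).Λ₂')
    (hmixdict : ∀ (F : T4Family) (θ : Stage12Params F N) (hP : θ.Provisos₁₂ F N), θ.Admissible F N → ∀ (g₀ : ℕ → ℝ) (os : List (ULoop F)),
        ∃ (σA σB : Type) (XA : ℕ → σA → Type) (XB : ℕ → σB → Type)
          (_mA : ∀ K s, MeasurableSpace (XA K s)) (_mB : ∀ K s, MeasurableSpace (XB K s))
          (νA : ∀ K : ℕ, ℝ → ∀ s : σA, Measure (XA K s)) (νB : ∀ K : ℕ, ℝ → ∀ s : σB, Measure (XB K s))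
          (_fA : ∀ K t s, IsFiniteMeasure (νA K t s)) (_fB : ∀ K t s, IsFiniteMeasure (νB K t s))
          (wA : ∀ K : ℕ, ℝ → ∀ s : σA, XA K s → ℝ) (wB : ∀ K : ℕ, ℝ → ∀ s : σB, XB K s → ℝ)
          (SA : ℕ → Finset σA) (SB : ℕ → Finset σB)
          (pieceA : ℕ → ℝ → σA → (cr F θ hP g₀ os).ι → ℝ) (pieceB : ℕ → ℝ → σB → (cr F θ hP g₀ os).ι → ℝ)
          (lvlA : ℕ → σA → ℕ) (lvlB : ℕ → σB → ℕ) (θA κA ρA θB κB ρB : ℕ → ℝ)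
          (MA : ℕ → ℝ → σA → ℝ) (MB : ℕ → ℝ → σB → ℝ)
          (pcA AsA : ∀ K : ℕ, ℝ → ∀ s : σA, ℝ → (cr F θ hP g₀ os).ι → ℝ) (pcB AsB : ∀ K : ℕ, ℝ → ∀ s : σB, ℝ → (cr F θ hP g₀ os).ι → ℝ)
          (τA τB : ℕ → ℝ) (N₁ : ℕ) (νbar κmin ε' cg c₂ ϑ₂ : ℝ),
          -- run A: (R), measurability, signs, integrability, SHARP pushes at every threshold of the window, carriers pinned as window averages
          (∀ K t, |t| ≤ (cr F θ hP g₀ os).l₀ → ∀ τ ∈ (cr F θ hP g₀ os).T K, 0 ≤ (cr F θ hP g₀ os).shA K t τ) ∧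
          (∀ K t, |t| ≤ (cr F θ hP g₀ os).l₀ → ∀ τ ∈ (cr F θ hP g₀ os).T K, (cr F θ hP g₀ os).shA K t τ ≤ (cr F θ hP g₀ os).A K t τ) ∧
          (∀ K t, |t| ≤ (cr F θ hP g₀ os).l₀ → ∀ τ ∈ (cr F θ hP g₀ os).T K, (cr F θ hP g₀ os).shA K t τ ≤ ∑ s ∈ SA K, pieceA K t s τ) ∧
          (∀ K t s, Measurable (wA K t s)) ∧ (∀ j, 0 < θA j) ∧ (∀ j, 0 < κA j ∧ κA j < 1) ∧ (∀ j, 0 ≤ ρA j) ∧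
          (∀ K t, |t| ≤ (cr F θ hP g₀ os).l₀ → ∀ s ∈ SA K, 0 ≤ MA K t s) ∧
          (∀ K t, |t| ≤ (cr F θ hP g₀ os).l₀ → ∀ s ∈ SA K, ∀ τ ∈ (cr F θ hP g₀ os).T K,
            IntegrableOn (fun s' => pcA K t s s' τ) (Icc ((1 - κA (lvlA K s)) * θA (lvlA K s)) (θA (lvlA K s)))) ∧
          (∀ K t, |t| ≤ (cr F θ hP g₀ os).l₀ → ∀ s ∈ SA K, ∀ τ ∈ (cr F θ hP g₀ os).T K,
            IntegrableOn (fun s' => AsA K t s s' τ) (Icc ((1 - κA (lvlA K s)) * θA (lvlA K s)) (θA (lvlA K s)))) ∧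
          (∀ K t, |t| ≤ (cr F θ hP g₀ os).l₀ → ∀ s ∈ SA K, ∀ s' ∈ Icc ((1 - κA (lvlA K s)) * θA (lvlA K s)) (θA (lvlA K s)),
            ∑ τ ∈ (cr F θ hP g₀ os).T K, pcA K t s s' τ ≤ MA K t s * (νA K t s {x | s' * (1 - ρA (lvlA K s)) ≤ wA K t s x ∧ wA K t s x < s'}).toReal) ∧
          (∀ K t, |t| ≤ (cr F θ hP g₀ os).l₀ → ∀ s ∈ SA K, ∀ s' ∈ Icc ((1 - κA (lvlA K s)) * θA (lvlA K s)) (θA (lvlA K s)),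
            MA K t s * (νA K t s univ).toReal ≤ ∑ τ ∈ (cr F θ hP g₀ os).T K, AsA K t s s' τ) ∧
          (∀ K t, |t| ≤ (cr F θ hP g₀ os).l₀ → ∀ s ∈ SA K, ∀ τ ∈ (cr F θ hP g₀ os).T K, pieceA K t s τ =
            (κA (lvlA K s) * θA (lvlA K s))⁻¹ * ∫ s' in Icc ((1 - κA (lvlA K s)) * θA (lvlA K s)) (θA (lvlA K s)), pcA K t s s' τ) ∧
          (∀ K t, |t| ≤ (cr F θ hP g₀ os).l₀ → ∀ s ∈ SA K, ∀ τ ∈ (cr F θ hP g₀ os).T K, (cr F θ hP g₀ os).A K t τ =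
            (κA (lvlA K s) * θA (lvlA K s))⁻¹ * ∫ s' in Icc ((1 - κA (lvlA K s)) * θA (lvlA K s)) (θA (lvlA K s)), AsA K t s s' τ) ∧
          -- run B: the same
          (∀ K t, |t| ≤ (cr F θ hP g₀ os).l₀ → ∀ τ ∈ (cr F θ hP g₀ os).T K, 0 ≤ (cr F θ hP g₀ os).shB K t τ) ∧
          (∀ K t, |t| ≤ (cr F θ hP g₀ os).l₀ → ∀ τ ∈ (cr F θ hP g₀ os).T K, (cr F θ hP g₀ os).shB K t τ ≤ (cr F θ hP g₀ os).B K t τ) ∧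
          (∀ K t, |t| ≤ (cr F θ hP g₀ os).l₀ → ∀ τ ∈ (cr F θ hP g₀ os).T K, (cr F θ hP g₀ os).shB K t τ ≤ ∑ s ∈ SB K, pieceB K t s τ) ∧
          (∀ K t s, Measurable (wB K t s)) ∧ (∀ j, 0 < θB j) ∧ (∀ j, 0 < κB j ∧ κB j < 1) ∧ (∀ j, 0 ≤ ρB j) ∧
          (∀ K t, |t| ≤ (cr F θ hP g₀ os).l₀ → ∀ s ∈ SB K, 0 ≤ MB K t s) ∧
          (∀ K t, |t| ≤ (cr F θ hP g₀ os).l₀ → ∀ s ∈ SB K, ∀ τ ∈ (cr F θ hP g₀ os).T K,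
            IntegrableOn (fun s' => pcB K t s s' τ) (Icc ((1 - κB (lvlB K s)) * θB (lvlB K s)) (θB (lvlB K s)))) ∧
          (∀ K t, |t| ≤ (cr F θ hP g₀ os).l₀ → ∀ s ∈ SB K, ∀ τ ∈ (cr F θ hP g₀ os).T K,
            IntegrableOn (fun s' => AsB K t s s' τ) (Icc ((1 - κB (lvlB K s)) * θB (lvlB K s)) (θB (lvlB K s)))) ∧
          (∀ K t, |t| ≤ (cr F θ hP g₀ os).l₀ → ∀ s ∈ SB K, ∀ s' ∈ Icc ((1 - κB (lvlB K s)) * θB (lvlB K s)) (θB (lvlB K s)),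
            ∑ τ ∈ (cr F θ hP g₀ os).T K, pcB K t s s' τ ≤ MB K t s * (νB K t s {x | s' * (1 - ρB (lvlB K s)) ≤ wB K t s x ∧ wB K t s x < s'}).toReal) ∧
          (∀ K t, |t| ≤ (cr F θ hP g₀ os).l₀ → ∀ s ∈ SB K, ∀ s' ∈ Icc ((1 - κB (lvlB K s)) * θB (lvlB K s)) (θB (lvlB K s)),
            MB K t s * (νB K t s univ).toReal ≤ ∑ τ ∈ (cr F θ hP g₀ os).T K, AsB K t s s' τ) ∧
          (∀ K t, |t| ≤ (cr F θ hP g₀ os).l₀ → ∀ s ∈ SB K, ∀ τ ∈ (cr F θ hP g₀ os).T K, pieceB K t s τ =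
            (κB (lvlB K s) * θB (lvlB K s))⁻¹ * ∫ s' in Icc ((1 - κB (lvlB K s)) * θB (lvlB K s)) (θB (lvlB K s)), pcB K t s s' τ) ∧
          (∀ K t, |t| ≤ (cr F θ hP g₀ os).l₀ → ∀ s ∈ SB K, ∀ τ ∈ (cr F θ hP g₀ os).T K, (cr F θ hP g₀ os).B K t τ =
            (κB (lvlB K s) * θB (lvlB K s))⁻¹ * ∫ s' in Icc ((1 - κB (lvlB K s)) * θB (lvlB K s)) (θB (lvlB K s)), AsB K t s s' τ) ∧
          -- windows (N20), admissible widths, rate (N16), record weight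
          LiveWindow SA lvlA N₁ νbar ∧ LiveWindow SB lvlB N₁ νbar ∧ 0 < κmin ∧ (∀ j, κmin ≤ κA j) ∧ (∀ j, κmin ≤ κB j) ∧
          0 < ε' ∧ 0 ≤ cg ∧ 0 ≤ c₂ ∧ 0 ≤ ϑ₂ ∧ ϑ₂ < 1 ∧ (∀ j, τA j ≤ c₂ * ϑ₂ ^ j) ∧ (∀ j, τB j ≤ c₂ * ϑ₂ ^ j) ∧
          -- the two [dict] clauses at the layer `o F`: width = N16's relative closeness + threshold width
          (∀ j, 1 ≤ j → ∀ x : ℝ,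
            (∀ (V UA UB : B7Prop1Explicit.Site 4 → Fin 4 → (Matrix (Fin N) (Fin N) ℂ)ˣ) (z : B7Prop1Explicit.Site 4) (μ ν : Fin 4) (t : ℝ),
              V ∈ (o F).dom → IsMinimiser 4 (sfClass 4 F.L (o F).Nper (o F).ε) F.L (o F).Nper j V UA →
              IsMinimiser 4 (sfClass 4 F.L (o F).Nper (o F).ε) F.L (o F).Nper (j + 1) V UB → Regular 4 F.L (o F).Nper (o F).b (o F).g (j + 1) UB →
              ε' * ((F.L : ℝ)⁻¹) ^ (2 * j) ≤ t →
              |‖((hol UA z (plaqWord μ ν) : (Matrix (Fin N) (Fin N) ℂ)ˣ) : Matrix (Fin N) (Fin N) ℂ) - 1‖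
                  - ‖((hol (rescale F.L (bavg F.L UB)) z (plaqWord μ ν) : (Matrix (Fin N) (Fin N) ℂ)ˣ) : Matrix (Fin N) (Fin N) ℂ) - 1‖| / t ≤ x) →
            ρA j ≤ x + τA j) ∧
          (∀ j, 1 ≤ j → ∀ x : ℝ,
            (∀ (V UA UB : B7Prop1Explicit.Site 4 → Fin 4 → (Matrix (Fin N) (Fin N) ℂ)ˣ) (z : B7Prop1Explicit.Site 4) (π : Plane 4)
              (r₀ : Fin 4 → Fin F.L) (i₀ j₀ : ℕ) (t : ℝ),
              V ∈ (o F).dom → IsMinimiser 4 (sfClass 4 F.L (o F).Nper (o F).ε) F.L (o F).Nper j V UA →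
              IsMinimiser 4 (sfClass 4 F.L (o F).Nper (o F).ε) F.L (o F).Nper (j + 1) V UB → Regular 4 F.L (o F).Nper (o F).b (o F).g (j + 1) UB →
              RegularSup 4 F.L (o F).Nper (o F).b cg (j + 1) UB → i₀ < F.L → j₀ < F.L → ε' * ((F.L : ℝ)⁻¹) ^ (2 * j) ≤ t →
              |‖((hol UA z (plaqWord π.1.1 π.1.2) : (Matrix (Fin N) (Fin N) ℂ)ˣ) : Matrix (Fin N) (Fin N) ℂ) - 1‖
                  - (F.L : ℝ) ^ 2 * ‖((hol UB ((F.L : ℤ) • z + boxVec F.L r₀ + (i₀ : ℤ) • e π.1.1 + (j₀ : ℤ) • e π.1.2)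
                      (plaqWord π.1.1 π.1.2) : (Matrix (Fin N) (Fin N) ℂ)ˣ) : Matrix (Fin N) (Fin N) ℂ) - 1‖| / t ≤ x) →
            ρB j ≤ x + τB j))
    (h14 : S_N14 (RRec₁₂ 𝔯)) (h15 : S_N15 (RRec₁₂ 𝔯)) (h16 : S_N16 (RRec₁₂ 𝔯)) (h17 : S_N17 (RRec₁₂ 𝔯)) (h18 : S_N18 (RRec₁₂ 𝔯)) (h22 : S_N22 (RRec₁₂ 𝔯))
    (hx' : S_N27x (fun F D w => IsRecordOfRecord₁₂C F N D w) (SRec₁₂ cr)) (h20 : S_N20 (SRec₁₂ cr))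
    (h19 : ∀ (F : T4Family) (θ : Stage12Params F N) (hP : θ.Provisos₁₂ F N), θ.Admissible F N → ∀ (g₀ : ℕ → ℝ) (os : List (ULoop F))
      (h : IsDatumOfRecord₁₂C F N (datumOfRecord₁₂ F N θ hP)) (k : ℕ),
      RatesAt (datumOfRecord₁₂ F N θ hP) (rateCarriersOfRecord₁₂ 𝔯 F h.params h.provisos g₀ os k) → letI := (cr F θ hP g₀ os).dec
        ∃ δ : ℕ → ℝ, NE7.Core (cr F θ hP g₀ os).l₀ (cr F θ hP g₀ os).vol (cr F θ hP g₀ os).T (cr F θ hP g₀ os).Bad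
          (fun K t τ => (cr F θ hP g₀ os).A K t τ - (cr F θ hP g₀ os).shA K t τ) (fun K t τ => (cr F θ hP g₀ os).B K t τ - (cr F θ hP g₀ os).shB K t τ) δ ∧
          Summable δ) :
    Spine (N := N) fun F D w => IsRecordOfRecord₁₂C F N D w := by
  refine spine_rec12C_of_homes₁₂_existsShellWeight cr 𝔯 h14 h15 h16 h17 h18 h22 hx' h20 (fun F θ hP hθ g₀ os => ?_) h19
  obtain ⟨σA, σB, XA, XB, mA, mB, νA, νB, fA, fB, wA, wB, SA, SB, pieceA, pieceB, lvlA, lvlB, θA, κA, ρA, θB, κB, ρB, MA, MB,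
    pcA, AsA, pcB, AsB, τA, τB, N₁, νbar, κmin, ε', cg, c₂, ϑ₂, sh_nonnegA, sh_leA, coverA, hwA, hθA, hκA, hρA, hMA, hpcA, hAsA, hpushA, htotalA,
    hpieceMixA, hAMixA, sh_nonnegB, sh_leB, coverB, hwB, hθB, hκB, hρB, hMB, hpcB, hAsB, hpushB, htotalB, hpieceMixB, hAMixB, hwinA, hwinB, hκmin,
    hκminA, hκminB, hε', hcg, hc₂, h₂, h₂', hτA, hτB, hdictA, hdictB⟩ := hmixdict F θ hP hθ g₀ os
  obtain ⟨ϑ, C, -, -, -, hSW⟩ := shellWeightBound_geometric_of_rRec₁₂_constLayer_thresholdMixture sh_nonnegA sh_leA coverA hwA hθA hκA hρA hMA hpcA hAsA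
    hpushA htotalA hpieceMixA hAMixA sh_nonnegB sh_leB coverB hwB hθB hκB hρB hMB hpcB hAsB hpushB htotalB hpieceMixB hAMixB hwinA hwinB hκmin hκminA
    hκminB hc₂ h₂ h₂' hτA hτB 𝔯 o hconst h16 (isDatumOfRecord₁₂C_datumOfRecord₁₂ F N θ hP hθ) (hreg F) (hnum F).1 (hnum F).2 hε' hcg hdictA hdictB
  exact ⟨_, hSW⟩

end Summit.QuantumFields.YangMills.Theorems.N21AtRRec12ConstLayerMixture

end
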